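import Mathlib
import Literature.Barriers.ValiantsHypothesis.AlgebraicNaturalProofs
import Summits.ValiantsHypothesis.ValiantsHypothesis.Theorems.BarrierLeverSuccinctHittingSetsForVPLowDegree
import HarnessLib

/-!
# Crux `BarrierLever.SuccinctHittingSetsForVP` (stmt-ValiantsHypothesis-14610), line `registered` —
FULL-SUPPORT SHIFTS OF SPARSE POLYNOMIALS HAVE A NARROW MONOMIAL (registered stub
`stub_shiftSmallSupport`; it does NOT close the item)

**What is proved.** Forbes–Shpilka–Volk 2018, Lemma 32 (= Forbes 2015; Gurjar–Korwar–Saxena–Thierauf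
2016), over `ℂ` and for an arbitrary index type `ι`, CONDITIONALLY on Oliveira's product-sparsity
bound (the statement of the neighbouring stub `stub_prodSparsity`, taken verbatim as the first
hypothesis): if every `a i ≠ 0` and `D ≠ 0`, the Taylor shift `D(a + X)` — formally
`aeval (fun i => C (a i) + X i) D` — has a monomial `m` with `2 ^ |supp m| ≤ |supp D|`, i.e. a
monomial involving at most `log₂ (sparsity D)` variables (`stub_shiftSmallSupport`,
`ShiftSmallSupport.exists_narrow_monomial`).

**Proof.** Let `G = D(a + X) ≠ 0` (the shift is inverted by `X ↦ X - a`, `unshift_shift`) and let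
`m₀` be a monomial of `G` with the fewest variables, `S = supp m₀`. Killing the variables outside
`S` (`X i ↦ 0` for `i ∉ S`) leaves a nonzero polynomial `P` (`LowDegree.coeff_subst_self`) whose
monomials are monomials of `G` supported inside `S` (`support_subst_subset`), hence, by minimality,
supported on exactly `S`; so `∏_{i ∈ S} X_i ∣ P` (`prod_X_dvd`), `P = (∏_{i ∈ S} X_i) · H`,
`H ≠ 0`. Un-shifting (`X ↦ X - a`) turns `P` into `(∏_{i ∈ S} (X_i - a_i)) · H(X - a)` with
`H(X - a) ≠ 0`, which has `≥ 2^|S|` monomials by the hypothesis; and at the same time into the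
partial evaluation `D(X_i (i ∈ S), a_i (i ∉ S))` of `D` (`unshift_subst_shift`: the three
substitutions compose to `X i ↦ X i` on `S`, `X i ↦ a i` off `S`), which has at most `|supp D|`
monomials (`card_support_partialEval_le`: a monomial `x^m` evaluates to a scalar multiple of
`x^{m|S}`). Axioms: `propext`, `Classical.choice`, `Quot.sound`.

References: [ForbesShpilkaVolk2018] Lemma 32 (statement), Lemma 33 (the hypothesis);
[Forbes2015], [GurjarKorwarSaxenaThierauf2016] (original sources of the lemma).
-/

-- layout Summits/ValiantsHypothesis/ValiantsHypothesis forces the duplicated namespace component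
set_option linter.dupNamespace false

namespace Summit.ValiantsHypothesis.ValiantsHypothesis.Theorems.BarrierLever.SuccinctHittingSetsForVP

open Literature.Barriers.ValiantsHypothesis Literature.Computability.AlgebraicComplexity MvPolynomial

namespace ShiftSmallSupport

variable {ι : Type*}

/-! The Taylor shift by `a` is `aeval (fun i => C (a i) + X i)` (`X i ↦ a i + X i`), its inverse is
`aeval (fun i => X i - C (a i))`; killing the variables outside `S` is
`aeval (fun i => if i ∈ S then X i else 0)` and the partial evaluation at `a` off `S` is
`aeval (fun i => if i ∈ S then X i else C (a i))`. All four are spelled out in each statement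
(no auxiliary definitions). -/

/-- Un-shifting the shift: substituting `X - a` into `D(a + X)` gives back `D`. [folklore] -/
theorem unshift_shift (a : ι → ℂ) (D : MvPolynomial ι ℂ) :
    aeval (fun i => X i - C (a i)) (aeval (fun i => C (a i) + X i) D) = D := by
  have key : ((aeval fun i => X i - C (a i)) : MvPolynomial ι ℂ →ₐ[ℂ] MvPolynomial ι ℂ).comp
      (aeval fun i => C (a i) + X i) = AlgHom.id ℂ (MvPolynomial ι ℂ) :=
    MvPolynomial.algHom_ext fun i => by simp
  exact AlgHom.congr_fun key D

/-- Shifting the un-shift: substituting `a + X` into `D(X - a)` gives back `D`. [folklore] -/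
theorem shift_unshift (a : ι → ℂ) (D : MvPolynomial ι ℂ) :
    aeval (fun i => C (a i) + X i) (aeval (fun i => X i - C (a i)) D) = D := by
  have key : ((aeval fun i => C (a i) + X i) : MvPolynomial ι ℂ →ₐ[ℂ] MvPolynomial ι ℂ).comp
      (aeval fun i => X i - C (a i)) = AlgHom.id ℂ (MvPolynomial ι ℂ) :=
    MvPolynomial.algHom_ext fun i => by simp
  exact AlgHom.congr_fun key D

/-- A polynomial each of whose monomials involves every variable of `S` is divisible by
`∏_{i ∈ S} X_i`. [folklore] -/
theorem prod_X_dvd (S : Finset ι) (P : MvPolynomial ι ℂ) (h : ∀ m ∈ P.support, S ⊆ m.support) :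
    (∏ i ∈ S, (X i : MvPolynomial ι ℂ)) ∣ P := by
  conv_rhs => rw [P.as_sum]
  refine Finset.dvd_sum fun m hm => ?_
  rw [monomial_eq, Finsupp.prod]
  refine dvd_mul_of_dvd_right ?_ _
  refine (Finset.prod_dvd_prod_of_dvd _ _ fun i hi => ?_).trans
    (Finset.prod_dvd_prod_of_subset S m.support _ (h m hm))
  exact dvd_pow_self (X i) (Finsupp.mem_support_iff.mp (h m hm hi))

variable [DecidableEq ι]

/-- Shift by `a`, kill the variables outside `S`, un-shift: the composite is the partial
evaluation `X i ↦ X i` (`i ∈ S`), `X i ↦ a i` (`i ∉ S`). [folklore] -/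
theorem unshift_subst_shift (S : Finset ι) (a : ι → ℂ) (D : MvPolynomial ι ℂ) :
    aeval (fun i => X i - C (a i))
        (aeval (fun i => if i ∈ S then (X i : MvPolynomial ι ℂ) else 0)
          (aeval (fun i => C (a i) + X i) D)) =
      aeval (fun i => if i ∈ S then X i else C (a i)) D := by
  have key :
      ((aeval fun i => X i - C (a i)) : MvPolynomial ι ℂ →ₐ[ℂ] MvPolynomial ι ℂ).comp
          (((aeval fun i => if i ∈ S then (X i : MvPolynomial ι ℂ) else 0) :
              MvPolynomial ι ℂ →ₐ[ℂ] MvPolynomial ι ℂ).comp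
            (aeval fun i => C (a i) + X i)) =
        aeval (fun i => if i ∈ S then X i else C (a i)) :=
    MvPolynomial.algHom_ext fun i => by
      simp only [AlgHom.comp_apply, aeval_X, map_add, aeval_C, algebraMap_eq]
      split_ifs <;> simp
  exact AlgHom.congr_fun key D

/-- Killing the variables outside `S` keeps exactly the monomials supported inside `S` (and
creates no new ones). [folklore] -/
theorem support_subst_subset (S : Finset ι) (G : MvPolynomial ι ℂ) :
    (aeval (fun i => if i ∈ S then (X i : MvPolynomial ι ℂ) else 0) G).support ⊆
      G.support.filter fun m => m.support ⊆ S := by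
  intro m hm
  have hsum : aeval (fun i => if i ∈ S then (X i : MvPolynomial ι ℂ) else 0) G =
      ∑ m ∈ G.support, aeval (fun i => if i ∈ S then (X i : MvPolynomial ι ℂ) else 0)
        (monomial m (coeff m G)) := by
    conv_lhs => rw [G.as_sum]
    rw [map_sum]
  rw [hsum] at hm
  obtain ⟨m', hm', hmm'⟩ := Finset.mem_biUnion.mp (support_sum hm)
  by_cases h : m'.support ⊆ S
  · rw [LowDegree.subst_monomial_of_subset S h] at hmm'
    rw [Finset.mem_singleton.mp (support_monomial_subset hmm')]
    exact Finset.mem_filter.mpr ⟨hm', h⟩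
  · rw [LowDegree.subst_monomial_of_not_subset S h, support_zero] at hmm'
    exact absurd hmm' (Finset.notMem_empty _)

/-- Partial evaluation sends a term to a term: `c · x^m ↦ (c ∏_{i ∉ S} a_i^{m_i}) · x^{m|S}`.
[folklore] -/
theorem partialEval_monomial (S : Finset ι) (a : ι → ℂ) (m : ι →₀ ℕ) (c : ℂ) :
    aeval (fun i => if i ∈ S then X i else C (a i)) (monomial m c) =
      monomial (m.filter (· ∈ S)) (c * ∏ i ∈ m.support.filter (· ∉ S), a i ^ m i) := by
  rw [aeval_monomial, Finsupp.prod, algebraMap_eq,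
    ← Finset.prod_filter_mul_prod_filter_not m.support (· ∈ S)]
  have h1 : ∏ i ∈ m.support.filter (· ∈ S),
      (if i ∈ S then (X i : MvPolynomial ι ℂ) else C (a i)) ^ m i =
        monomial (m.filter (· ∈ S)) 1 := by
    rw [← prod_X_pow_eq_monomial, Finsupp.support_filter]
    refine Finset.prod_congr rfl fun i hi => ?_
    rw [Finset.mem_filter] at hi
    rw [if_pos hi.2, Finsupp.filter_apply_pos _ _ hi.2]
  have h2 : ∏ i ∈ m.support.filter (fun i => ¬ i ∈ S),
      (if i ∈ S then (X i : MvPolynomial ι ℂ) else C (a i)) ^ m i =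
        C (∏ i ∈ m.support.filter (· ∉ S), a i ^ m i) := by
    rw [map_prod]
    refine Finset.prod_congr rfl fun i hi => ?_
    rw [Finset.mem_filter] at hi
    rw [if_neg hi.2, map_pow]
  rw [h1, h2, mul_comm (monomial _ _) (C _), ← mul_assoc, ← C_mul, C_mul_monomial, mul_one]

/-- Partial evaluation does not increase the number of monomials: the monomials of
`D(X_i (i ∈ S), a_i (i ∉ S))` are restrictions to `S` of monomials of `D`. [folklore] -/
theorem card_support_partialEval_le (S : Finset ι) (a : ι → ℂ) (D : MvPolynomial ι ℂ) :
    (aeval (fun i => if i ∈ S then X i else C (a i)) D).support.card ≤ D.support.card := by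
  have hsub : (aeval (fun i => if i ∈ S then X i else C (a i)) D).support ⊆
      D.support.image fun m => m.filter (· ∈ S) := by
    have hsum : aeval (fun i => if i ∈ S then X i else C (a i)) D =
        ∑ m ∈ D.support, monomial (m.filter (· ∈ S))
          (coeff m D * ∏ i ∈ m.support.filter (· ∉ S), a i ^ m i) := by
      conv_lhs => rw [D.as_sum]
      rw [map_sum]
      exact Finset.sum_congr rfl fun m _ => partialEval_monomial S a m _
    intro m' hm'
    rw [hsum] at hm'
    obtain ⟨m, hm, hmm'⟩ := Finset.mem_biUnion.mp (support_sum hm')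
    exact Finset.mem_image.mpr
      ⟨m, hm, (Finset.mem_singleton.mp (support_monomial_subset hmm')).symm⟩
  exact (Finset.card_le_card hsub).trans Finset.card_image_le

/-- The heart of FSV18 Lemma 32: if every monomial of `G` supported inside `S` is supported on
exactly `S`, and killing the variables outside `S` leaves `G` nonzero, then the un-shift of the
killed polynomial is `(∏_{i ∈ S} (X_i - a_i)) · H` with `H ≠ 0`.
[cite: ForbesShpilkaVolk2018, Lemma 32] -/
theorem unshift_subst_eq_prod_mul (S : Finset ι) (a : ι → ℂ) (G : MvPolynomial ι ℂ)
    (hmin : ∀ m ∈ G.support, m.support ⊆ S → m.support = S)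
    (hP0 : aeval (fun i => if i ∈ S then (X i : MvPolynomial ι ℂ) else 0) G ≠ 0) :
    ∃ H : MvPolynomial ι ℂ, H ≠ 0 ∧
      aeval (fun i => X i - C (a i))
          (aeval (fun i => if i ∈ S then (X i : MvPolynomial ι ℂ) else 0) G) =
        (∏ i ∈ S, (X i - C (a i))) * H := by
  obtain ⟨Hq, hHq⟩ :=
    prod_X_dvd S (aeval (fun i => if i ∈ S then (X i : MvPolynomial ι ℂ) else 0) G)
      fun m hm => by
        obtain ⟨hmG, hsub⟩ := Finset.mem_filter.mp (support_subst_subset S G hm)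
        exact (Finset.Subset.antisymm_iff.mp (hmin m hmG hsub)).2
  refine ⟨aeval (fun i => X i - C (a i)) Hq, fun h0 => hP0 ?_, ?_⟩
  · rw [hHq, ← shift_unshift a Hq, h0, map_zero, mul_zero]
  · rw [hHq, map_mul, map_prod]
    simp only [aeval_X]

/-- **FSV18 Lemma 32 for a fixed index type**, from the product-sparsity bound `hP1` for the fixed
shift vector `a`: a nonzero `D` shifted by `a` has a monomial `m` with `2 ^ |supp m| ≤ |supp D|`.
[cite: ForbesShpilkaVolk2018, Lemma 32] -/
theorem exists_narrow_monomial (a : ι → ℂ)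
    (hP1 : ∀ (S : Finset ι) (H : MvPolynomial ι ℂ), H ≠ 0 →
      2 ^ S.card ≤ ((∏ i ∈ S, (X i - C (a i))) * H).support.card)
    {D : MvPolynomial ι ℂ} (hD : D ≠ 0) :
    ∃ m ∈ (aeval (fun i => C (a i) + X i) D).support, 2 ^ m.support.card ≤ D.support.card := by
  -- the shift `G = D(a + X)` is nonzero
  have hG0 : aeval (fun i => C (a i) + X i) D ≠ 0 := fun h0 =>
    hD (by rw [← unshift_shift a D, h0, map_zero])
  -- a monomial `m₀` of `G` with the fewest variables, `S = supp m₀`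
  obtain ⟨m₀, hm₀, hmin⟩ := (aeval (fun i => C (a i) + X i) D).support.exists_min_image
    (fun m => m.support.card) (support_nonempty.mpr hG0)
  refine ⟨m₀, hm₀, ?_⟩
  -- killing the variables outside `S` leaves `G` nonzero (the coefficient of `m₀` survives)
  have hP0 : aeval (fun i => if i ∈ m₀.support then (X i : MvPolynomial ι ℂ) else 0)
      (aeval (fun i => C (a i) + X i) D) ≠ 0 := by
    intro h0
    have h := LowDegree.coeff_subst_self m₀.support (aeval (fun i => C (a i) + X i) D)
      (subset_refl m₀.support)
    rw [h0, coeff_zero] at h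
    exact (mem_support_iff.mp hm₀) h.symm
  -- un-shift: `(∏_{i ∈ S} (X_i - a_i)) · H = D(X_S, a_{Sᶜ})`
  obtain ⟨H, hH0, hfac⟩ := unshift_subst_eq_prod_mul m₀.support a
    (aeval (fun i => C (a i) + X i) D)
    (fun m hm hsub => Finset.eq_of_subset_of_card_le hsub (hmin m hm)) hP0
  rw [unshift_subst_shift] at hfac
  calc 2 ^ m₀.support.card
      ≤ ((∏ i ∈ m₀.support, (X i - C (a i))) * H).support.card := hP1 _ H hH0
    _ = (aeval (fun i => if i ∈ m₀.support then X i else C (a i)) D).support.card := by rw [hfac]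
    _ ≤ D.support.card := card_support_partialEval_le _ a D

end ShiftSmallSupport

open ShiftSmallSupport

/-- **Registered stub `stub_shiftSmallSupport`** (crux stmt-ValiantsHypothesis-14610, line
`registered`; FSV18 Lemma 32 = [Forbes15], [GKST16], CONDITIONAL on the statement of the
neighbouring stub `stub_prodSparsity`, taken verbatim as the first hypothesis): if `D ≠ 0` and
every `a i ≠ 0`, the Taylor shift `D(a + X)` has a monomial `m` with `2 ^ |supp m| ≤ |supp D|`,
i.e. of support `≤ log₂ (sparsity D)`. [cite: ForbesShpilkaVolk2018, Lemma 32] -/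
theorem stub_shiftSmallSupport :
    (∀ (ι : Type) (S : Finset ι) (a : ι → ℂ), (∀ i ∈ S, a i ≠ 0) →
      ∀ H : MvPolynomial ι ℂ, H ≠ 0 →
        2 ^ S.card ≤ ((∏ i ∈ S, (X i - C (a i))) * H).support.card) →
    ∀ (ι : Type) (a : ι → ℂ), (∀ i, a i ≠ 0) →
      ∀ D : MvPolynomial ι ℂ, D ≠ 0 →
        ∃ m ∈ (aeval (fun i => C (a i) + X i) D).support, 2 ^ m.support.card ≤ D.support.card := by
  intro hP1 ι a ha D hD
  classical
  exact exists_narrow_monomial a (fun S H hH => hP1 ι S a (fun i _ => ha i) H hH) hD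

end Summit.ValiantsHypothesis.ValiantsHypothesis.Theorems.BarrierLever.SuccinctHittingSetsForVP
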